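import Literature.Computability.AlgebraicComplexity.ValiantCriterion
import HarnessLib

/-!
# Crux `Capture` (stmt-PneNP-2659) — RAIL SUBSTITUTION in Valiant's criterion object:
# specialising the description block of a universal circuit-sum to one circuit

Part 2 of the kernel-checked VALIANT BARRIER of the crux
`Summit.PneNP.PneNP.Theses.ConvexRankGates.Capture` (route PneNP/ConvexRankGates; idea card
`Cruxes/Capture/Ideas/permanent-shadow-bridge.md`, ideator 4; lead c6, 2026-08-17).

Pure algebra over a commutative ring `k`. Let `Q` be a circuit on `n + (ℓ + ℓ)` inputs, read as a data block
`x ∈ {0,1}ⁿ` followed by two RAILS `y, y' ∈ {0,1}^ℓ`, which computes `u(x, y) ∧ [y' = ¬y]` (second rail = the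
complement of the first). Valiant's criterion object
`circuitSum Q = ∑_{(x,y,y')} [Q(x,y,y')] X^x Y^y Y'^{y'}` (`ValiantCriterion.circuitSum`) then specialises, under
the RAIL SUBSTITUTION `Xᵢ ↦ Xᵢ`, `Y_j ↦ [c_j]`, `Y'_j ↦ [¬c_j]` (constants `0/1`), to the generating function
`∑_x [u(x,c)] X^x` of the single slice `y = c`:

  `aeval_railSubst_circuitSum : … → aeval (rails c) (circuitSum Q) = circuitSum Q'`   whenever `Q'` computes `x ↦ u(x,c)`.

Reason: a monomial `Y^y Y'^{y'}` survives the substitution iff `y ≤ c` and `y' ≤ ¬c`, and together with the rail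
constraint `y' = ¬y` this forces `y = c` (`rails_iff`). With `u` = "the circuit described by `y` accepts `x`"
(a universal evaluation circuit, part 3) this says: the generating function of EVERY circuit of description
length `ℓ` on `n` inputs is a substitution instance — hence inherits every affine determinantal representation —
of ONE polynomial `circuitSum Q_{n,ℓ}`, which lies in `VNP` by Valiant's criterion. No new definitions. [folklore]
-/

namespace Summit.PneNP.PneNP.Theorems.Capture.ValiantBarrier

set_option linter.dupNamespace false -- `Summit.PneNP.PneNP.…`: summit = sub-problem (D-0017)

open Literature.Computability.Complexity Literature.Computability.AlgebraicComplexity MvPolynomial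
open Literature.Computability.AlgebraicComplexity.ValiantCriterion (circuitSum)
open Literature.Computability.AlgebraicComplexity.CircuitArith (toK)

universe u

variable {k : Type u} [CommRing k]

/-- A selector product of `0/1` constants is the `0/1` constant of the implication
`∏_j (if y_j then [b_j] else 1) = [∀ j, y_j → b_j]`. [folklore] -/
theorem prod_ite_C_toK {σ : Type*} {ℓ : ℕ} (y b : Fin ℓ → Bool) :
    (∏ j : Fin ℓ, (if y j = true then C (toK k (b j)) else 1) : MvPolynomial σ k) =
      C (toK k (decide (∀ j, y j = true → b j = true))) := by
  by_cases h : ∀ j, y j = true → b j = true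
  · rw [decide_eq_true h, CircuitArith.toK_true, C_1]
    refine Finset.prod_eq_one fun j _ => ?_
    by_cases hy : y j = true
    · rw [if_pos hy, h j hy, CircuitArith.toK_true, C_1]
    · rw [if_neg hy]
  · rw [decide_eq_false h, CircuitArith.toK_false, C_0]
    push Not at h
    obtain ⟨j, hy, hb⟩ := h
    refine Finset.prod_eq_zero (Finset.mem_univ j) ?_
    rw [if_pos hy, Bool.eq_false_iff.2 hb, CircuitArith.toK_false, C_0]

/-- **The two rails pin the description.** For `y, y', c ∈ {0,1}^ℓ`: `y' = ¬y` (rail constraint), `y ≤ c`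
(first rail survives `Y ↦ [c]`) and `y' ≤ ¬c` (second rail survives `Y' ↦ [¬c]`) hold together iff `y = c` and
`y' = ¬c`. [folklore] -/
theorem rails_iff {ℓ : ℕ} (y y' c : Fin ℓ → Bool) :
    ((∀ j, y' j = !y j) ∧ (∀ j, y j = true → c j = true) ∧ (∀ j, y' j = true → (!c j) = true)) ↔
      (y = c ∧ y' = fun j => !c j) := by
  constructor
  · rintro ⟨hD, hA, hB⟩
    have hyc : y = c := by
      funext j
      cases hy : y j with
      | true => exact (hA j hy).symm
      | false =>
        have h1 : y' j = true := by rw [hD j, hy]; rfl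
        have h2 := hB j h1
        cases hc : c j with
        | false => rfl
        | true => rw [hc] at h2; exact absurd h2 (by decide)
    refine ⟨hyc, funext fun j => ?_⟩
    rw [hD j, hyc]
  · rintro ⟨rfl, rfl⟩
    refine ⟨fun j => rfl, fun j h => h, fun j h => h⟩

/-- The summand of the specialised circuit-sum at `(x, y, y')` is the slice term if `(y, y') = (c, ¬c)` and
vanishes otherwise. [folklore] -/
theorem rail_summand_eq {n ℓ : ℕ} (u : (Fin n → Bool) → (Fin ℓ → Bool) → Bool) (c : Fin ℓ → Bool)
    (x : Fin n → Bool) (y y' : Fin ℓ → Bool) (P : MvPolynomial (Fin n) k) :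
    C (toK k (u x y && decide (∀ j, y' j = !y j))) *
        (P * (C (toK k (decide (∀ j, y j = true → c j = true))) *
          C (toK k (decide (∀ j, y' j = true → (!c j) = true))))) =
      if (y = c ∧ y' = fun j => !c j) then C (toK k (u x c)) * P else 0 := by
  by_cases h : (y = c ∧ y' = fun j => !c j)
  · rw [if_pos h]
    obtain ⟨rfl, rfl⟩ := h
    have hD : decide (∀ j, (fun j => !y j) j = !y j) = true := decide_eq_true fun j => rfl
    have hA : decide (∀ j, y j = true → y j = true) = true := decide_eq_true fun j h => h
    have hB : decide (∀ j, (fun j => !y j) j = true → (!y j) = true) = true := decide_eq_true fun j h => h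
    rw [hD, hA, hB, Bool.and_true, CircuitArith.toK_true, C_1, mul_one, mul_one]
  · rw [if_neg h]
    have h' := mt (rails_iff y y' c).1 h
    by_cases hD : ∀ j, y' j = !y j
    · by_cases hA : ∀ j, y j = true → c j = true
      · have hB : ¬ ∀ j, y' j = true → (!c j) = true := fun hB => h' ⟨hD, hA, hB⟩
        rw [decide_eq_false hB, CircuitArith.toK_false, C_0, mul_zero, mul_zero, mul_zero]
      · rw [decide_eq_false hA, CircuitArith.toK_false, C_0, zero_mul, mul_zero, mul_zero]
    · rw [decide_eq_false hD, Bool.and_false, CircuitArith.toK_false, C_0, zero_mul]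

/-- Pushing an algebra map through Valiant's criterion object. [folklore] -/
theorem aeval_circuitSum {m : ℕ} {σ : Type*} (φ : Fin m → MvPolynomial σ k) (Q : Circuit (Fin m)) :
    aeval φ (circuitSum (k := k) Q) =
      ∑ e : Fin m → Bool, C (toK k (Q.eval e)) * ∏ t : Fin m, (if e t = true then φ t else 1) := by
  unfold ValiantCriterion.circuitSum
  simp only [map_sum, map_mul, aeval_C, algebraMap_eq, map_prod]
  refine Finset.sum_congr rfl fun e _ => ?_
  congr 1
  refine Finset.prod_congr rfl fun t _ => ?_
  split_ifs
  · rw [aeval_X]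
  · rw [map_one]

/-- Summing over `{0,1}^{a+b}` is summing over pairs glued by `Fin.append`. [folklore] -/
theorem sum_fin_add_eq_sum_sum {M : Type*} [AddCommMonoid M] {a b : ℕ} (G : (Fin (a + b) → Bool) → M) :
    ∑ e : Fin (a + b) → Bool, G e = ∑ x : Fin a → Bool, ∑ z : Fin b → Bool, G (Fin.append x z) := by
  rw [← Fintype.sum_prod_type']
  exact (Fintype.sum_equiv (Fin.appendEquiv a b) (fun p => G (Fin.append p.1 p.2)) G fun p => rfl).symm

/-- **Rail substitution** (registered sub-goal `aeval_railSubst_circuitSum` of the Valiant barrier). Let the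
circuit `Q` on the input blocks `x ∈ {0,1}ⁿ`, `y, y' ∈ {0,1}^ℓ` compute `u(x,y) ∧ [y' = ¬y]`. Then for every
`c ∈ {0,1}^ℓ`, substituting `Xᵢ ↦ Xᵢ`, `Y_j ↦ [c_j]`, `Y'_j ↦ [¬c_j]` in `circuitSum Q` yields `circuitSum Q'`
for any circuit `Q'` computing the slice `x ↦ u(x,c)`: the only monomials `Y^y Y'^{y'}` surviving are those with
`y ≤ c`, `y' ≤ ¬c`, and the rail constraint pins `(y, y') = (c, ¬c)` (`rails_iff`). [folklore] -/
theorem aeval_railSubst_circuitSum : ∀ {k : Type u} [CommRing k] {n ℓ : ℕ}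
    (Q : Circuit (Fin (n + (ℓ + ℓ)))) (u : (Fin n → Bool) → (Fin ℓ → Bool) → Bool),
    (∀ (x : Fin n → Bool) (y y' : Fin ℓ → Bool),
      Q.eval (Fin.append x (Fin.append y y')) = (u x y && decide (∀ j, y' j = !y j))) →
    ∀ (c : Fin ℓ → Bool) (Q' : Circuit (Fin n)), (∀ x, Q'.eval x = u x c) →
    MvPolynomial.aeval (Fin.append (fun i => MvPolynomial.X i)
        (Fin.append (fun j => MvPolynomial.C (toK k (c j))) (fun j => MvPolynomial.C (toK k (!c j)))))
      (ValiantCriterion.circuitSum (k := k) Q) = ValiantCriterion.circuitSum (k := k) Q' := by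
  intro k _ n ℓ Q u hQ c Q' hQ'
  rw [aeval_circuitSum, sum_fin_add_eq_sum_sum]
  unfold ValiantCriterion.circuitSum
  refine Finset.sum_congr rfl fun x _ => ?_
  rw [sum_fin_add_eq_sum_sum]
  -- the summand at `(x, y, y')`
  have hterm : ∀ y y' : Fin ℓ → Bool,
      C (toK k (Q.eval (Fin.append x (Fin.append y y')))) *
          ∏ t : Fin (n + (ℓ + ℓ)), (if Fin.append x (Fin.append y y') t = true then
            Fin.append (fun i => (X i : MvPolynomial (Fin n) k))
              (Fin.append (fun j => C (toK k (c j))) (fun j => C (toK k (!c j)))) t else 1) =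
        if (y = c ∧ y' = fun j => !c j) then
          C (toK k (u x c)) * ∏ t : Fin n, (if x t = true then X t else 1) else 0 := by
    intro y y'
    rw [hQ x y y', Fin.prod_univ_add, Fin.prod_univ_add]
    simp only [Fin.append_left, Fin.append_right]
    rw [prod_ite_C_toK, prod_ite_C_toK]
    exact rail_summand_eq u c x y y' _
  simp only [hterm]
  rw [Finset.sum_eq_single c]
  · rw [Finset.sum_eq_single (fun j => !c j)]
    · rw [if_pos ⟨rfl, rfl⟩, hQ' x]
    · intro y' _ hne
      rw [if_neg (fun h => hne h.2)]
    · intro h; exact absurd (Finset.mem_univ _) h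
  · intro y _ hne
    exact Finset.sum_eq_zero fun y' _ => by rw [if_neg (fun h => hne h.1)]
  · intro h; exact absurd (Finset.mem_univ _) h

end Summit.PneNP.PneNP.Theorems.Capture.ValiantBarrier
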